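import Literature.MathematicalPhysics.QuantumLattice.PairChirality
import Summits.HubbardSuperconductivity.HubbardSuperconductivity.Theorems.SoloBlindPairMinorityBound
import Summits.HubbardSuperconductivity.HubbardSuperconductivity.Theorems.SoloBlindFiniteVolumeCriterion
import HarnessLib

/-!
# Singlet pair order needs a macroscopic minority-spin population: the summit excludes
# (nearly) saturated ferromagnetism

Obstruction report, Theorem 14 (requirement R9).

**(a) Minority bound.** The pair field `Δ_g = Σ_x P_x` is a sum of SINGLET pairs
`c_{x↑} c_{x+e,↓} - c_{x↓} c_{x+e,↑}`; every term removes one down electron. Hence for every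
vector `φ` of the coordinate sector `(N↑, N↓) = (a, b)` of the torus of side `L`,

  `⟨φ, Δ_gᴴ Δ_g φ⟩ = ‖Δ_g φ‖² ≤ (2 Σ_e |g e/√2|)² · L² · b · ‖φ‖²`     (`= 32 L² b ‖φ‖²` for d-wave):

`‖Δ_g φ‖ ≤ Σ_{x,e} |g e/√2| (‖c_{x+e,↓} φ‖ + ‖c_{x,↓} φ‖) = 2 Σ_e|g e/√2| · Σ_y ‖c_{y↓} φ‖` and, by
Cauchy–Schwarz, `(Σ_y ‖c_{y↓} φ‖)² ≤ L² Σ_y ‖c_{y↓} φ‖² = L² ⟨φ, N_↓ φ⟩ = L² b ‖φ‖²`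
(`re_expect_pairField_le_minority`, file `SoloBlindPairMinorityBound`).

**(b) SU(2) transfer.** `Δ_gᴴ Δ_g` commutes with `S^±` (`PairChirality.spin_commute_localPair`).
For a highest-weight vector `ψ` (`S⁺ ψ = 0`) of the sector `(a, b)`, `a ≥ b`, the descendants
`ψ_k = (S⁻)^k ψ`, `k ≤ a - b`, are nonzero, lie in the sectors `(a - k, b + k)`, satisfy
`S⁺ ψ_{k+1} = (k+1)(a-b-k) ψ_k`, and for every `A` commuting with `S⁺` the Rayleigh quotient
`⟨ψ_k, A ψ_k⟩/‖ψ_k‖²` does not depend on `k` (`ladder_expect_mul_norm`). Consequently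
(`re_expect_pairField_ladder_le`) `⟨ψ_k, Δ_gᴴΔ_g ψ_k⟩ ≤ (2Σ_e|g e/√2|)² L² b ‖ψ_k‖²` along the whole
multiplet: the pair order of a spin multiplet is controlled by the minority population
`b = N/2 - S` of its TOP member, i.e. by `N/2 - S`.

**(c) Theorem 14** (`summit_excludes_near_saturated_ferromagnetism`). If `HubbardSuperconductivity`
holds (parameters `U, δ`), there are `c > 0` and `L₀` such that for every even `L ≥ L₀`, with
`N = 2m = 2⌊(1-δ)L²/2⌋`, every spin-`S` multiplet that reaches the ground energy of the sector
`(N, S^z = 0)` — i.e. every highest-weight `ψ ≠ 0` of the sector `(m + S, m - S)` with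
`H ψ = E₀(N, S^z = 0) ψ` — has

  `S ≤ N/2 - c L²/32`.

So a proof of the summit must, for its chosen `(U, δ)`, exclude saturated (Nagaoka) ferromagnetism
and every ground multiplet within `c L²/32` of saturation, uniformly in `L`. At small `U` this is
a two-line variational fact; at large `U` and small doping it is the open problem of the
(in)stability of the Nagaoka state at finite hole density (Nagaoka 1966; Tasaki 1998; Putikka–
Luchini–Ogata 1992), so the strong-coupling corner of the `∃ U` clause cannot be discharged
without settling it.

References: Y. Nagaoka, Phys. Rev. 147 (1966) 392; H. Tasaki, Prog. Theor. Phys. 99 (1998) 489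
(arXiv:cond-mat/9712219), §6; E. H. Lieb, Phys. Rev. Lett. 62 (1989) 1201 (SU(2) bookkeeping on
sectors); D. J. Scalapino, Phys. Rep. 250 (1995) 329, §2. Tags: [folklore] for (a), (b);
[this work] for the assembled statement (c).
-/

namespace Summit.HubbardSuperconductivity.HubbardSuperconductivity.Theorems.SpinPolarization

open Matrix Finset Literature.MathematicalPhysics.QuantumLattice HubbardWave0
  Literature.Probability.LatticeModels
open Literature.MathematicalPhysics.QuantumLattice.LiebThm1
open scoped ComplexOrder Matrix.Norms.L2Operator

-- file-local, as in the sibling `SoloBlind*` files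
attribute [-instance] instDecidableEqLex

/-! ### (b) The SU(2) ladder -/

section Ladder

variable {Λ : Type*} [LinearOrder Λ] [Fintype Λ]

local notation "Sp" => (spinPlus : Matrix (Finset (Orb Λ)) (Finset (Orb Λ)) ℂ)
local notation "Sm" => (Literature.MathematicalPhysics.QuantumLattice.spinMinus :
  Matrix (Finset (Orb Λ)) (Finset (Orb Λ)) ℂ)

/-- The descendants `ψ_k = (S⁻)^k ψ` lie in the sectors `(a - k, b + k)` (`k ≤ a`). [folklore] -/
theorem isInSector_spinMinus_pow_mulVec {a b : ℕ} {ψ : Fock (Orb Λ)} (hψ : IsInSector a b ψ) :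
    ∀ k, k ≤ a → IsInSector (a - k) (b + k) ((Sm ^ k) *ᵥ ψ) := by
  intro k
  induction k with
  | zero => intro _; simpa using hψ
  | succ k ih =>
    intro hk
    have hk' : k ≤ a := Nat.le_of_succ_le hk
    have h := ih hk'
    rw [pow_succ', ← mulVec_mulVec]
    have ha : a - k = (a - (k + 1)) + 1 := by omega
    rw [ha] at h
    have := lowersSpin_spinMinus.isInSector_mulVec h
    simpa [Nat.add_assoc] using this

/-- `S⁺ ψ_{k+1} = (k+1)(a-b-k) ψ_k` for a highest-weight `ψ` of the sector `(a, b)` (`k + 1 ≤ a`):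
`S⁺S⁻ = S⁻S⁺ + 2S^z` and `S^z ψ_k = ½(a - b - 2k) ψ_k`. [folklore] -/
theorem spinPlus_mulVec_ladder {a b : ℕ} {ψ : Fock (Orb Λ)} (hψ : IsInSector a b ψ)
    (hhw : Sp *ᵥ ψ = 0) :
    ∀ k, k + 1 ≤ a →
      Sp *ᵥ ((Sm ^ (k + 1)) *ᵥ ψ) =
        (((k : ℂ) + 1) * ((a : ℂ) - b - k)) • ((Sm ^ k) *ᵥ ψ) := by
  -- the commutation relation applied to a vector of the sector `(a - k, b + k)`
  have hcomm : ∀ k, k ≤ a → Sp *ᵥ (Sm *ᵥ ((Sm ^ k) *ᵥ ψ)) =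
      Sm *ᵥ (Sp *ᵥ ((Sm ^ k) *ᵥ ψ)) + ((a : ℂ) - b - 2 * k) • ((Sm ^ k) *ᵥ ψ) := by
    intro k hk
    have hsec := isInSector_spinMinus_pow_mulVec hψ k hk
    have h := congrArg (fun M => M *ᵥ ((Sm ^ k) *ᵥ ψ)) (spinPlus_mul_spinMinus_sub (Λ := Λ))
    simp only [sub_mulVec, ← mulVec_mulVec, Matrix.smul_mulVec] at h
    rw [LiebThm1.spinZ_mulVec_of_isInSector hsec, smul_smul] at h
    rw [sub_eq_iff_eq_add'] at h
    rw [h]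
    congr 2
    push_cast [Nat.cast_sub hk]
    ring
  intro k
  induction k with
  | zero =>
    intro _
    have h := hcomm 0 (Nat.zero_le _)
    rw [pow_zero, one_mulVec, hhw, mulVec_zero, zero_add] at h
    rw [zero_add, pow_one, pow_zero, one_mulVec, h]
    congr 1
    push_cast
    ring
  | succ k ih =>
    intro hk
    have hk1 : k + 1 ≤ a := by omega
    rw [pow_succ' _ (k + 1), ← mulVec_mulVec, hcomm (k + 1) hk1, ih hk1, mulVec_smul,
      mulVec_mulVec, ← pow_succ', ← add_smul]
    congr 1
    push_cast
    ring

/-- **Rayleigh quotients are constant along the multiplet.** For `A` commuting with `S⁺`, a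
highest-weight `ψ` of the sector `(a, b)` and `k ≤ a`:
`⟨ψ_k, A ψ_k⟩ · ⟨ψ, ψ⟩ = ⟨ψ, A ψ⟩ · ⟨ψ_k, ψ_k⟩`. [folklore] -/
theorem ladder_expect_mul_norm {a b : ℕ} {ψ : Fock (Orb Λ)} (hψ : IsInSector a b ψ)
    (hhw : Sp *ᵥ ψ = 0) {A : Matrix (Finset (Orb Λ)) (Finset (Orb Λ)) ℂ} (hA : Commute Sp A) :
    ∀ k, k ≤ a →
      star ((Sm ^ k) *ᵥ ψ) ⬝ᵥ (A *ᵥ ((Sm ^ k) *ᵥ ψ)) * (star ψ ⬝ᵥ ψ) =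
        star ψ ⬝ᵥ (A *ᵥ ψ) * (star ((Sm ^ k) *ᵥ ψ) ⬝ᵥ ((Sm ^ k) *ᵥ ψ)) := by
  have hSmH : (Sm)ᴴ = Sp := by
    rw [Literature.MathematicalPhysics.QuantumLattice.spinMinus, conjTranspose_conjTranspose]
  -- one step: `⟨S⁻χ, B S⁻χ⟩ = ⟨χ, S⁺ B S⁻ χ⟩`
  have hstep : ∀ (B : Matrix (Finset (Orb Λ)) (Finset (Orb Λ)) ℂ) (χ : Fock (Orb Λ)),
      star (Sm *ᵥ χ) ⬝ᵥ (B *ᵥ (Sm *ᵥ χ)) = star χ ⬝ᵥ (Sp *ᵥ (B *ᵥ (Sm *ᵥ χ))) := by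
    intro B χ
    rw [ThermodynamicLimit.star_mulVec_dotProduct, hSmH]
  have hstep1 : ∀ χ : Fock (Orb Λ),
      star (Sm *ᵥ χ) ⬝ᵥ (Sm *ᵥ χ) = star χ ⬝ᵥ (Sp *ᵥ (Sm *ᵥ χ)) := by
    intro χ
    rw [ThermodynamicLimit.star_mulVec_dotProduct, hSmH]
  intro k
  induction k with
  | zero => intro _; simp [mul_comm]
  | succ k ih =>
    intro hk
    have hk' : k ≤ a := by omega
    set c : ℂ := ((k : ℂ) + 1) * ((a : ℂ) - b - k) with hc
    have hlad' : Sp *ᵥ (Sm *ᵥ ((Sm ^ k) *ᵥ ψ)) = c • ((Sm ^ k) *ᵥ ψ) := by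
      have := spinPlus_mulVec_ladder hψ hhw k hk
      rwa [pow_succ', ← mulVec_mulVec] at this
    have hA' : Sp *ᵥ (A *ᵥ (Sm *ᵥ ((Sm ^ k) *ᵥ ψ))) = c • (A *ᵥ ((Sm ^ k) *ᵥ ψ)) := by
      rw [mulVec_mulVec, hA.eq, ← mulVec_mulVec, hlad', mulVec_smul]
    rw [pow_succ', ← mulVec_mulVec, hstep A, hA', dotProduct_smul, smul_eq_mul, hstep1, hlad',
      dotProduct_smul, smul_eq_mul, mul_assoc, ih hk']
    ring

/-- **The multiplet below a highest-weight vector is nonzero**: `⟨ψ_k, ψ_k⟩ > 0` for `k ≤ a - b`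
(`‖ψ_{k+1}‖² = (k+1)(a-b-k) ‖ψ_k‖²`). [folklore] -/
theorem ladder_norm_pos {a b : ℕ} {ψ : Fock (Orb Λ)} (hψ : IsInSector a b ψ)
    (hhw : Sp *ᵥ ψ = 0) (h0 : ψ ≠ 0) :
    ∀ k, k ≤ a - b → 0 < star ((Sm ^ k) *ᵥ ψ) ⬝ᵥ ((Sm ^ k) *ᵥ ψ) := by
  intro k
  induction k with
  | zero =>
    intro _
    rw [pow_zero, one_mulVec]
    exact lt_of_le_of_ne (dotProduct_star_self_nonneg ψ)
      (fun h => h0 ((star_dotProduct_self_eq_zero_iff ψ).1 h.symm))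
  | succ k ih =>
    intro hk
    have hk' : k ≤ a - b := by omega
    have hka : k + 1 ≤ a := by omega
    have hlad' : Sp *ᵥ (Sm *ᵥ ((Sm ^ k) *ᵥ ψ)) =
        (((k : ℂ) + 1) * ((a : ℂ) - b - k)) • ((Sm ^ k) *ᵥ ψ) := by
      have := spinPlus_mulVec_ladder hψ hhw k hka
      rwa [pow_succ', ← mulVec_mulVec] at this
    have hSmH : (Sm)ᴴ = Sp := by
      rw [Literature.MathematicalPhysics.QuantumLattice.spinMinus, conjTranspose_conjTranspose]
    have hstep : star (Sm *ᵥ ((Sm ^ k) *ᵥ ψ)) ⬝ᵥ (Sm *ᵥ ((Sm ^ k) *ᵥ ψ)) =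
        star ((Sm ^ k) *ᵥ ψ) ⬝ᵥ (Sp *ᵥ (Sm *ᵥ ((Sm ^ k) *ᵥ ψ))) := by
      rw [ThermodynamicLimit.star_mulVec_dotProduct, hSmH]
    rw [pow_succ', ← mulVec_mulVec, hstep, hlad', dotProduct_smul, smul_eq_mul]
    refine mul_pos ?_ (ih hk')
    have hre : ((k : ℂ) + 1) * ((a : ℂ) - b - k) = (((k + 1) * (a - b - k) : ℕ) : ℂ) := by
      push_cast [Nat.cast_sub (show b ≤ a by omega), Nat.cast_sub (show k ≤ a - b by omega)]
      ring
    rw [hre]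
    exact_mod_cast Nat.mul_pos (Nat.succ_pos k) (by omega)

end Ladder

/-! ### (b') Pair order along a multiplet -/

section LadderPair

variable (g : Site 2 → ℝ) {L : ℕ} [NeZero L]

local notation "Sp" => (spinPlus : Matrix (Finset (Orb (FermionTorus 2 L))) (Finset (Orb (FermionTorus 2 L))) ℂ)
local notation "Sm" => (Literature.MathematicalPhysics.QuantumLattice.spinMinus :
  Matrix (Finset (Orb (FermionTorus 2 L))) (Finset (Orb (FermionTorus 2 L))) ℂ)

/-- `Δ_gᴴ Δ_g` commutes with `S⁺` (singlet pairs). [folklore] -/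
theorem spinPlus_commute_pairOrder : Commute Sp ((pairField g L)ᴴ * pairField g L) := by
  have h1 : Commute Sp (pairField g L) := by
    rw [pairField]
    exact Commute.sum_right _ _ _ fun x _ => (PairChirality.spin_commute_localPair L g x).1
  have h2 : Commute Sp (pairField g L)ᴴ := by
    rw [pairField, conjTranspose_sum]
    exact Commute.sum_right _ _ _ fun x _ => (PairChirality.spin_commute_localPair L g x).2.2.1
  exact h2.mul_right h1

/-- **(b) Pair order along the multiplet of a highest-weight vector** of the sector `(a, b)`,
`b ≤ a`: `re ⟨ψ_k, Δ_gᴴΔ_g ψ_k⟩ ≤ (2Σ_e|g e/√2|)² L² b · re ⟨ψ_k, ψ_k⟩` for all `k ≤ a - b` — the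
bound is set by the minority population `b` of the TOP member. [folklore] -/
theorem re_expect_pairField_ladder_le {a b : ℕ} {ψ : Fock (Orb (FermionTorus 2 L))}
    (hψ : IsInSector a b ψ) (hhw : Sp *ᵥ ψ = 0) (h0 : ψ ≠ 0) (k : ℕ) (hk : k ≤ a - b) :
    (star ((Sm ^ k) *ᵥ ψ) ⬝ᵥ ((pairField g L)ᴴ * pairField g L) *ᵥ ((Sm ^ k) *ᵥ ψ)).re ≤
      (2 * ∑ e ∈ insert (0 : Site 2) unitSteps, |g e / Real.sqrt 2|) ^ 2 * (L : ℝ) ^ 2 * b *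
        (star ((Sm ^ k) *ᵥ ψ) ⬝ᵥ ((Sm ^ k) *ᵥ ψ)).re := by
  set O := (pairField g L)ᴴ * pairField g L with hO
  set K := (2 * ∑ e ∈ insert (0 : Site 2) unitSteps, |g e / Real.sqrt 2|) ^ 2 * (L : ℝ) ^ 2 * b
    with hK
  have hka : k ≤ a := by omega
  have hmul := ladder_expect_mul_norm hψ hhw (spinPlus_commute_pairOrder g) k hka
  -- all four scalars are real
  have hn0 : star ψ ⬝ᵥ ψ = ((star ψ ⬝ᵥ ψ).re : ℂ) := ThermodynamicLimit.star_dotProduct_self_eq_re ψ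
  have hnk : star ((Sm ^ k) *ᵥ ψ) ⬝ᵥ ((Sm ^ k) *ᵥ ψ) =
      ((star ((Sm ^ k) *ᵥ ψ) ⬝ᵥ ((Sm ^ k) *ᵥ ψ)).re : ℂ) :=
    ThermodynamicLimit.star_dotProduct_self_eq_re _
  have hpos0 : 0 < (star ψ ⬝ᵥ ψ).re := by
    have := ladder_norm_pos hψ hhw h0 0 (Nat.zero_le _)
    rw [pow_zero, one_mulVec] at this
    exact (Complex.pos_iff.1 this).1
  have hre := congrArg Complex.re hmul
  rw [hn0, hnk, Complex.mul_re, Complex.mul_re, Complex.ofReal_re, Complex.ofReal_im,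
    Complex.ofReal_re, Complex.ofReal_im, mul_zero, sub_zero, mul_zero, sub_zero] at hre
  -- the top member obeys the minority bound
  have htop := re_expect_pairField_le_minority g hψ
  rw [← hK] at htop
  -- `E_k n_0 = E_0 n_k ≤ K n_0 n_k`
  have hnk0 : 0 ≤ (star ((Sm ^ k) *ᵥ ψ) ⬝ᵥ ((Sm ^ k) *ᵥ ψ)).re := by
    rw [← enorm_sq_eq_re]; positivity
  have : (star ((Sm ^ k) *ᵥ ψ) ⬝ᵥ O *ᵥ ((Sm ^ k) *ᵥ ψ)).re * (star ψ ⬝ᵥ ψ).re ≤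
      K * (star ((Sm ^ k) *ᵥ ψ) ⬝ᵥ ((Sm ^ k) *ᵥ ψ)).re * (star ψ ⬝ᵥ ψ).re := by
    rw [hre]
    calc (star ψ ⬝ᵥ O *ᵥ ψ).re * (star ((Sm ^ k) *ᵥ ψ) ⬝ᵥ ((Sm ^ k) *ᵥ ψ)).re
        ≤ K * (star ψ ⬝ᵥ ψ).re * (star ((Sm ^ k) *ᵥ ψ) ⬝ᵥ ((Sm ^ k) *ᵥ ψ)).re :=
          mul_le_mul_of_nonneg_right htop hnk0
      _ = _ := by ring
  exact le_of_mul_le_mul_right this hpos0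

end LadderPair

/-! ### (c) Theorem 14 -/

section SummitConsequence

/-- **SU(2) descent of a ground multiplet.** Let `ψ ≠ 0` be a highest-weight vector of the
sector `(m + S, m - S)` (`S ≤ m`) of the torus with `H ψ = E₀(2m, S^z = 0) ψ`. Then
`ψ₀ = (S⁻)^S ψ` is a ground state of the sector `(2m, S^z = 0)`. Lieb, PRL 62 (1989) 1201 ("all
competitors have a representative there"). [folklore] -/
theorem isGroundStateInSector_descend {L : ℕ} [NeZero L] (t U : ℝ) {m S : ℕ} (hS : S ≤ m)
    {ψ : Fock (Orb (FermionTorus 2 L))} (h0 : ψ ≠ 0) (hψ : IsInSector (m + S) (m - S) ψ)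
    (hhw : spinPlus *ᵥ ψ = 0)
    (hE : hubbardTorus 2 L t U *ᵥ ψ =
      (((hubbardTorus 2 L t U).minEnergyOn (szSector (2 * m) 0) : ℝ) : ℂ) • ψ) :
    IsGroundStateInSector (hubbardTorus 2 L t U) (2 * m) 0 ((spinMinus ^ S) *ᵥ ψ) := by
  refine ⟨?_, ?_, ?_⟩
  · -- sector `(m, m)`, i.e. `szSector (2m) 0`
    have hsec := isInSector_spinMinus_pow_mulVec hψ S (by omega)
    have hm1 : m + S - S = m := by omega
    have hm2 : m - S + S = m := by omega
    rw [hm1, hm2] at hsec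
    have := (mem_szSector_iff_isInSector m m _).2 hsec
    simpa [two_mul] using this
  · intro hzero
    have hpos := ladder_norm_pos hψ hhw h0 S (by omega)
    rw [hzero, dotProduct_zero] at hpos
    exact lt_irrefl _ hpos
  · have hcomm : Commute (hubbardTorus 2 L t U) (spinMinus ^ S) :=
      (hamiltonian_commute_spinMinus (fermionTorusGraph 2 L) t U).pow_right S
    rw [mulVec_mulVec, hcomm.eq, ← mulVec_mulVec, hE, mulVec_smul]

/-- **Theorem 14 (the summit excludes nearly saturated ferromagnetism).** If
`HubbardSuperconductivity` holds then, for its parameters `U, δ`, there are `c > 0` and `L₀` such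
that on every torus of even side `L = n + 1 ≥ L₀`, with `N = 2m`, `m = ⌊(1-δ)L²/2⌋`: every
highest-weight vector `ψ ≠ 0` of a sector `(m + S, m - S)`, `S ≤ m`, whose energy is the ground
energy of the sector `(N, S^z = 0)` — i.e. every ground multiplet of total spin `S` — satisfies
`S ≤ N/2 - c L²/32`. [this work] -/
theorem summit_excludes_near_saturated_ferromagnetism (h : HubbardSuperconductivity) :
    ∃ U : ℝ, 0 < U ∧ ∃ δ ∈ Set.Ioo (0 : ℝ) (1 / 2), ∃ c : ℝ, 0 < c ∧ ∃ L₀ : ℕ,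
      ∀ n : ℕ, Even (n + 1) → L₀ ≤ n + 1 →
        ∀ S : ℕ, S ≤ ⌊(1 - δ) * ((n + 1 : ℕ) : ℝ) ^ 2 / 2⌋₊ →
          ∀ ψ : Fock (Orb (FermionTorus 2 (n + 1))), ψ ≠ 0 →
            IsInSector (⌊(1 - δ) * ((n + 1 : ℕ) : ℝ) ^ 2 / 2⌋₊ + S)
              (⌊(1 - δ) * ((n + 1 : ℕ) : ℝ) ^ 2 / 2⌋₊ - S) ψ →
            spinPlus *ᵥ ψ = 0 →
            hubbardTorus 2 (n + 1) 1 U *ᵥ ψ =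
              (((hubbardTorus 2 (n + 1) 1 U).minEnergyOn
                  (szSector (2 * ⌊(1 - δ) * ((n + 1 : ℕ) : ℝ) ^ 2 / 2⌋₊) 0) : ℝ) : ℂ) • ψ →
              (S : ℝ) ≤ ⌊(1 - δ) * ((n + 1 : ℕ) : ℝ) ^ 2 / 2⌋₊ - c * ((n + 1 : ℕ) : ℝ) ^ 2 / 32 := by
  obtain ⟨U, hU, δ, hδ, c, hc, L₀, hmain⟩ := uniform_dWave_bound_of_hubbardSuperconductivity h
  refine ⟨U, hU, δ, hδ, c, hc, L₀, ?_⟩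
  intro n hev hL S hS ψ h0 hψ hhw hE
  set m := ⌊(1 - δ) * ((n + 1 : ℕ) : ℝ) ^ 2 / 2⌋₊ with hm
  -- the `S^z = 0` member of the multiplet, normalised
  set ψ₀ := (spinMinus ^ S) *ᵥ ψ with hψ₀
  have hgs : IsGroundStateInSector (hubbardTorus 2 (n + 1) 1 U) (2 * m) 0 ψ₀ :=
    isGroundStateInSector_descend 1 U hS h0 hψ hhw hE
  have hpos : 0 < star ψ₀ ⬝ᵥ ψ₀ := ladder_norm_pos hψ hhw h0 S (by omega)
  have hposre : 0 < (star ψ₀ ⬝ᵥ ψ₀).re := (Complex.pos_iff.1 hpos).1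
  have hreal : star ψ₀ ⬝ᵥ ψ₀ = ((star ψ₀ ⬝ᵥ ψ₀).re : ℂ) :=
    ThermodynamicLimit.star_dotProduct_self_eq_re ψ₀
  set r : ℝ := Real.sqrt (star ψ₀ ⬝ᵥ ψ₀).re with hr
  have hr0 : 0 < r := Real.sqrt_pos.2 hposre
  have hr2 : r ^ 2 = (star ψ₀ ⬝ᵥ ψ₀).re := Real.sq_sqrt hposre.le
  set φ := ((r⁻¹ : ℝ) : ℂ) • ψ₀ with hφ
  have hφ1 : star φ ⬝ᵥ φ = 1 := by
    rw [hφ, star_smul, smul_dotProduct, dotProduct_smul, smul_smul, hreal, Complex.star_def,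
      Complex.conj_ofReal, smul_eq_mul, ← hr2]
    push_cast
    field_simp
  have hφgs : IsGroundStateInSector (hubbardTorus 2 (n + 1) 1 U) (2 * m) 0 φ := by
    refine ⟨Submodule.smul_mem _ _ hgs.1, ?_, ?_⟩
    · rw [hφ]
      exact smul_ne_zero (by exact_mod_cast (inv_ne_zero hr0.ne')) hgs.2.1
    · rw [hφ, mulVec_smul, hgs.2.2, smul_comm]
  -- lower bound from the summit, upper bound from the ladder
  have hlow := hmain n hev hL φ hφ1 hφgs
  have hup := re_expect_pairField_ladder_le dWaveFormFactor hψ hhw h0 S (by omega)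
  rw [← hψ₀] at hup
  have hmS : m + S - (m - S) = 2 * S := by omega
  have hup' : (star φ ⬝ᵥ ((pairField dWaveFormFactor (n + 1))ᴴ * pairField dWaveFormFactor (n + 1))
      *ᵥ φ).re ≤ 32 * ((n + 1 : ℕ) : ℝ) ^ 2 * ((m - S : ℕ) : ℝ) := by
    have hsc : (star φ ⬝ᵥ ((pairField dWaveFormFactor (n + 1))ᴴ * pairField dWaveFormFactor (n + 1))
        *ᵥ φ).re = r⁻¹ ^ 2 * (star ψ₀ ⬝ᵥ ((pairField dWaveFormFactor (n + 1))ᴴ *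
          pairField dWaveFormFactor (n + 1)) *ᵥ ψ₀).re := by
      rw [hφ, mulVec_smul, star_smul, smul_dotProduct, dotProduct_smul, smul_smul, Complex.star_def,
        Complex.conj_ofReal, smul_eq_mul, ← Complex.ofReal_mul, Complex.re_ofReal_mul]
      ring
    rw [hsc]
    have hK := dWave_coupling_sq_le
    have h32 : (star ψ₀ ⬝ᵥ ((pairField dWaveFormFactor (n + 1))ᴴ * pairField dWaveFormFactor (n + 1))
        *ᵥ ψ₀).re ≤ 32 * ((n + 1 : ℕ) : ℝ) ^ 2 * ((m - S : ℕ) : ℝ) * (star ψ₀ ⬝ᵥ ψ₀).re := by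
      refine hup.trans ?_
      have h0' : 0 ≤ ((n + 1 : ℕ) : ℝ) ^ 2 * ((m - S : ℕ) : ℝ) * (star ψ₀ ⬝ᵥ ψ₀).re := by positivity
      calc _ = (2 * ∑ e ∈ insert (0 : Site 2) unitSteps, |dWaveFormFactor e / Real.sqrt 2|) ^ 2 *
            (((n + 1 : ℕ) : ℝ) ^ 2 * ((m - S : ℕ) : ℝ) * (star ψ₀ ⬝ᵥ ψ₀).re) := by ring
        _ ≤ 32 * (((n + 1 : ℕ) : ℝ) ^ 2 * ((m - S : ℕ) : ℝ) * (star ψ₀ ⬝ᵥ ψ₀).re) :=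
            mul_le_mul_of_nonneg_right hK h0'
        _ = _ := by ring
    calc r⁻¹ ^ 2 * (star ψ₀ ⬝ᵥ ((pairField dWaveFormFactor (n + 1))ᴴ *
          pairField dWaveFormFactor (n + 1)) *ᵥ ψ₀).re
        ≤ r⁻¹ ^ 2 * (32 * ((n + 1 : ℕ) : ℝ) ^ 2 * ((m - S : ℕ) : ℝ) * (star ψ₀ ⬝ᵥ ψ₀).re) :=
          mul_le_mul_of_nonneg_left h32 (by positivity)
      _ = 32 * ((n + 1 : ℕ) : ℝ) ^ 2 * ((m - S : ℕ) : ℝ) * (r⁻¹ ^ 2 * r ^ 2) := by rw [hr2]; ring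
      _ = _ := by rw [inv_pow, inv_mul_cancel₀ (pow_ne_zero 2 hr0.ne')]; ring
  have hfin : c * ((n + 1 : ℕ) : ℝ) ^ 4 ≤ 32 * ((n + 1 : ℕ) : ℝ) ^ 2 * ((m - S : ℕ) : ℝ) :=
    hlow.trans hup'
  rw [Nat.cast_sub hS] at hfin
  have hL2 : (0 : ℝ) < ((n + 1 : ℕ) : ℝ) ^ 2 := by positivity
  -- divide by `32 L²`
  have : c * ((n + 1 : ℕ) : ℝ) ^ 2 ≤ 32 * ((m : ℝ) - S) := by
    have h4 : c * ((n + 1 : ℕ) : ℝ) ^ 4 = (c * ((n + 1 : ℕ) : ℝ) ^ 2) * ((n + 1 : ℕ) : ℝ) ^ 2 := by ring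
    have h5 : 32 * ((n + 1 : ℕ) : ℝ) ^ 2 * ((m : ℝ) - S) = (32 * ((m : ℝ) - S)) * ((n + 1 : ℕ) : ℝ) ^ 2 := by
      ring
    rw [h4, h5] at hfin
    exact le_of_mul_le_mul_right hfin hL2
  linarith

end SummitConsequence

end Summit.HubbardSuperconductivity.HubbardSuperconductivity.Theorems.SpinPolarization
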